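import Summits.Ventures.PercRepro2.CaseOneStarCertT1
import Summits.Ventures.PercRepro2.CaseOneGadgetUWA1BBlockII0
import Summits.Ventures.PercRepro2.CaseOneGadgetUWA1BBlockII1
import Summits.Ventures.PercRepro2.CaseOneGadgetUWA1BBlockII2
import Summits.Ventures.PercRepro2.CaseOneGadgetUWA1BBlockII3
import Summits.Ventures.PercRepro2.CaseOneGadgetUWA1BBlockII4
import Summits.Ventures.PercRepro2.CaseOneGadgetUWA1BBlockII5
import Summits.Ventures.PercRepro2.CaseOneGadgetUWA1BBlockII6
import Summits.Ventures.PercRepro2.CaseOneGadgetUWA1BBlockII7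
import Summits.Ventures.PercRepro2.CaseOneGadgetUWA1BBlockII8
import Summits.Ventures.PercRepro2.CaseOneGadgetUWA1BBlockII9
import Summits.Ventures.PercRepro2.CaseOneGadgetUWA1BBlockII10
import Summits.Ventures.PercRepro2.CaseOneGadgetUWA1BBlockII11
import Summits.Ventures.PercRepro2.CaseOneGadgetUWA1BBlockII12
import Summits.Ventures.PercRepro2.CaseOneGadgetUWA1BBlockII13
import Summits.Ventures.PercRepro2.CaseOneGadgetUWA1BBlockII14
import Summits.Ventures.PercRepro2.CaseOneStarFactsB

/-!
# The gadget `u ~ {w, a₁, b}`, `w ~ {u, a₂, o}` (uwa1b): the cell certificates of `iiAB5` (part 32a)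
(blind cell PercRepro2, p1 g34; the fourth gadget anchor of the six-form calculus — all six forms of the uwa1b gadget
as plain SFacts-cone certificate chains, generated by mining/p1/g34/uwa1b/genu.py = p1 g33's gent_uwa1.py / g25's
geno.py re-targeted; P1-G33 §6–§6″, P1-G34)

Each `eBABII ijk kl` is a nonnegative combination of `(pairwise atom) × (cell)` and cubic cell monomials — or, for the degree-4 ones, `M × eBABII ijk kl` (`M = Σ cᵢ` the total cell mass) is a nonnegative combination of `(atom) × (cell) × (cell)` and quartic cell monomials, then `SFacts.nonneg_of_sum_mul` (`CaseOneStarCertT1`) — exact LP certificates (kit j318477, every certificate re-verified exactly; data/p1/g33/gcerts_ii_uwa1b.json, form `ii`), here as exact `linear_combination`s over `SFacts` (the rational coefficients cleared by their common denominator). -/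

namespace Summit.Ventures.PercRepro2

namespace CaseOne

section CertABII32a
variable {R : Type*} [Field R] [LinearOrder R] [IsStrictOrderedRing R]

set_option maxHeartbeats 0 in
/-- `eBABII22311 ≥ 0`: the combination is identically zero (`ring`). -/
lemma eBABII22311_nonneg (m : SCells R) (_hf : SFactsB m) : 0 ≤ eBABII22311 m := by
  have h : eBABII22311 m = 0 := by
    unfold eBABII22311 cBABII00111 cBABII00211 cBABII01011 cBABII01111 cBABII01211 cBABII01311 cBABII02011 cBABII02111 cBABII02211 cBABII02311 cBABII10011 cBABII10111 cBABII10211 cBABII10311 cBABII11011 cBABII11111 cBABII11211 cBABII11311 cBABII12011 cBABII12111 cBABII12211 cBABII12311 cBABII20011 cBABII20111 cBABII20211 cBABII20311 cBABII21011 cBABII21111 cBABII21211 cBABII21311 cBABII22011 cBABII22111 cBABII22211 cBABII22311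
    ring
  linarith [h]

set_option maxHeartbeats 0 in
/-- `eBABII22312 ≥ 0`: the combination is identically zero (`ring`). -/
lemma eBABII22312_nonneg (m : SCells R) (_hf : SFactsB m) : 0 ≤ eBABII22312 m := by
  have h : eBABII22312 m = 0 := by
    unfold eBABII22312 cBABII00112 cBABII00212 cBABII01012 cBABII01112 cBABII01212 cBABII01312 cBABII02012 cBABII02112 cBABII02212 cBABII02312 cBABII10012 cBABII10112 cBABII10212 cBABII10312 cBABII11012 cBABII11112 cBABII11212 cBABII11312 cBABII12012 cBABII12112 cBABII12212 cBABII12312 cBABII20012 cBABII20112 cBABII20212 cBABII20312 cBABII21012 cBABII21112 cBABII21212 cBABII21312 cBABII22012 cBABII22112 cBABII22212 cBABII22312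
    ring
  linarith [h]

end CertABII32a

end CaseOne

end Summit.Ventures.PercRepro2
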